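import Summits.QuantumFields.YangMills.Theorems.UnitScaleTiltProp7LODAssemblyMember
import Summits.QuantumFields.YangMills.Theorems.UnitScaleTiltProp7CoverTargetTransfer
import Summits.QuantumFields.YangMills.Theorems.UnitScaleTiltProp7ProjRTopMeanCover
import Summits.QuantumFields.YangMills.Theorems.UnitScaleTiltHalvingSmallMembersCoverLift
import HarnessLib

/-!
# Route `UnitScaleTilt`, crux K1 «MinimiserStabilityRegPr» (stmt-QuantumFields-19200), EX row `hGF` — **(L6) THE Idx-LEVEL KNIT: `hT` AT EVERY MEMBER FROM THE LARGE MEMBERS**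
# (chair ★`ym-ust-19200-p1` g25 CHAIR WORD №1: «small members are large members of the cover» = the road of record for S45; finish line (B) steps (1)(3)(4))

Cell `ym3-torus` (HUMAN RULING D-0037; rung R3 = SU(2) YM₃ on T³ — NOT d = 4, NOT infinite volume, NOT a mass gap, NOT Clay).  Width seat `ym3-torus-px10` (gen 11), holder of the Idx-level
knit `hT_allMembers` ((A) of the chair's 04:01:45Z question).  THEOREMS ONLY (0 `def`, 0 `sorry`); `--supports stmt-QuantumFields-19200 --as helper`; count-neutral.

WHAT.  The `hT` binder of ✓`Prop7GaugeFixedRowDoorOfLODTarget.gaugeFixedRow_idx_of_curvedTarget_of_le_coupling` asks, for EVERY member `i = (F, n, K)` of the display's index `Idx L`, every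
`U₀ ∈ RegPr (αLOD L)` and every top nested mean `Q″` (∀-form `htop`, kernel clause `hker`), the curved target `γLOD L·‖A‖² ≤ q_{U₀,Q″}(A)` with the coupling `aLOD L i = a₀(c₀∕cB)(L^{K−n})³`.
✓`Prop7LODAssemblyMember.curvedTarget_member[_of_hKP_hloc]` delivers it at the LARGE members (the scale-`s` cube family needs `s + 2 ≤ m + n`).  THIS FILE closes the gap to ALL members:
* §1 `hwrap_of_room` — the member theorem's no-wrap side condition from `1 ≤ s`, `s + 2 ≤ m + n` alone (`sitesPerDir 0 = 2L^{m+K}`, `L ≥ 3`);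
* §2 ★★★ `curvedTarget_all_of_large` — A SMALL MEMBER IS A LARGE MEMBER OF ITS COVER: read `(F, n, K)` on `F.cover (s₀+2)` (✓`SmallMembersCoverLift.regPr_cover_iff`; `Q″_c` := the intertwiner of
  record on the cover, ✓`exists_intertwiner_of_regPr` (iii)–(iv)); the large case gives the target there; routeR-w3 g13's (c2) ✓`Prop7ProjRTopMeanCover.norm_sq_projR_topMean_cover_le` the
  projector row; px17 g9's (c3) ✓`Prop7CoverTargetTransfer.curvedTarget_of_cover` the transfer — SAME `γ`, SAME coupling, no toron, no holonomy question;
* §3 ★★★ `hT_of_largeMembers` — the Idx packaging: the door's `hT` binder VERBATIM (`αcap := αLOD`, `γ := γLOD`, `aLOD` explicit) from ONE hypothesis `hlarge` (the target at the large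
  members for every `Q″` in ∀-form) = what the member assembly ⊕ its rows ⊕ w2 g12's window ✓`Prop7LODMemberWindow` supply.
HONEST SCOPE.  Packaging; `hlarge` is DISPLAYED, not proved; nothing of `hT`, `hGF`, (3.49), EX `stub_existenceMinimalOrbit` or the crux is proved; this is NOT the S45 event (the door's
application, the display and the pre-census are the namer's and the OWNER's).

References: T. Bałaban, CMP **99** (1985) 389–434 [Balaban1985BackgroundPropagators] ((3.49) p.399, Thm 3.3 p.398, Thm 3.11 p.416, (3.118)–(3.122) pp.419–420); CMP **109** (1987) 249–301
[Balaban1987RG1] ((0.1)–(0.2) pp.251–252: the `L^{jc}`-fold cover).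
-/

set_option autoImplicit false

noncomputable section

open scoped InnerProductSpace ComplexConjugate Matrix.Norms.L2Operator BigOperators

namespace Summit.QuantumFields.YangMills.Theorems.Prop7LODTargetAllMembers

open Literature.MathematicalPhysics.QuantumFieldTheory.Balaban1983to89
open Literature.MathematicalPhysics.QuantumFieldTheory.Balaban1983to89.T3ContinuumYM3Torus
open Literature.MathematicalPhysics.QuantumFieldTheory.Balaban1983to89.T3PrintedRegularMinimiser (RegPr regPr_one)
open T4Continuum BlockAveraging
open BlockAveraging (Idx)
open B7Prop1Explicit (disp)
open B10Eq27TorusAxialLog (holT transl axialT)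
open B7TransferAnalyticMean (meanCLM)
open B15DeterminingSets (embIter)
open B9Eq311L2Pairing (WL2)
open B11Eq103H1Complex (SiteL2K BondL2K projR)
open CoverSites (proj projBond T3Family.cover_L T3Family.cover_m)
open Summit.QuantumFields.YangMills.Theorems.SmallMembersCoverLift (regPr_cover_iff)
open Summit.QuantumFields.YangMills.Theorems.Prop8Chart (emlIterU)
open T3SectALandauChart (eta eta_pos bgUnits)
open T3RegularMinimiser (regThreshold regThreshold_pos)
open Summit.QuantumFields.YangMills.Theorems.Prop7SectET3Transport (periodsT3)
open Summit.QuantumFields.YangMills.Theorems.Prop7SectET3HilbertLetters (W₂ toL2 toL2S toL2B DL2 DstarL2 covLapSite)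
open Summit.QuantumFields.YangMills.Theorems.Prop7SectET3GaugeProjector (NS)
open Summit.QuantumFields.YangMills.Theorems.Prop7SectET3WilsonHessian (DeltaEta)
open Summit.QuantumFields.YangMills.Theorems.Prop7SectET3CurvedPropagators (Qk)
open Summit.QuantumFields.YangMills.Theorems.Prop7NSIntertwinerOfRecord (exists_intertwiner_of_regPr)
open Summit.QuantumFields.YangMills.Theorems.Prop7PTermLocalGaugeKnit (hseq_of_htop)
open Summit.QuantumFields.YangMills.Theorems.Prop7CoverTargetTransfer (curvedTarget_of_cover)
open Summit.QuantumFields.YangMills.Theorems.Prop7ProjRTopMeanCover (norm_sq_projR_topMean_cover_le)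

/-- (P1) THE CUBE FAMILY FITS: `1 ≤ s`, `s + 2 ≤ m + n` ⟹ the no-wrap room `2·(3L^sℓ + 8ℓ + 1) ≤ sitesPerDir 0 = 2L^{m+K}` of ✓`Prop7LODAssemblyMember.curvedTarget_member`
(`ℓ = L^{K−n}`, `L ≥ 3` odd); reused verbatim on the cover member `(F.cover jc, n, K)` whose volume exponent is `m + jc`. [folklore] -/
theorem hwrap_of_room (F : T3Family) {n K s : ℕ} (hnK : n ≤ K) (hs : 1 ≤ s) (hroom : s + 2 ≤ F.m + n) :
    2 * ((3 * (F.L ^ s * F.L ^ (K - n))) + 8 * (F.P K).L ^ (K - n) + 1) ≤ (F.P K).sitesPerDir 0 := by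
  have hL : 3 ≤ F.L := by
    obtain ⟨⟨k, hk⟩, h1⟩ := F.hL
    omega
  show 2 * ((3 * (F.L ^ s * F.L ^ (K - n))) + 8 * F.L ^ (K - n) + 1) ≤ 2 * F.L ^ (F.m + K - 0)
  rw [Nat.sub_zero]
  have hexp : s + 2 + (K - n) ≤ F.m + K := by omega
  have hpow : F.L ^ (s + 2 + (K - n)) ≤ F.L ^ (F.m + K) := Nat.pow_le_pow_right (by omega) hexp
  have hsplit : F.L ^ (s + 2 + (K - n)) = F.L ^ 2 * F.L ^ s * F.L ^ (K - n) := by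
    rw [pow_add, pow_add]; ring
  have hLs : 3 ≤ F.L ^ s := le_trans hL (by simpa using Nat.pow_le_pow_right (by omega : 1 ≤ F.L) hs)
  have hℓ : 1 ≤ F.L ^ (K - n) := Nat.one_le_pow _ _ (by omega)
  have hL2 : 9 ≤ F.L ^ 2 := by nlinarith
  nlinarith [hpow, hsplit, hLs, hℓ, hL2, Nat.zero_le (F.L ^ s * F.L ^ (K - n))]

/-- ★★★ **SMALL MEMBERS ARE LARGE MEMBERS OF THE COVER — THE CURVED TARGET AT EVERY MEMBER FROM THE CURVED TARGET AT THE LARGE ONES** (★p1 g24∕g25's road of record for S45,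
CHAIR WORD №1 (A)).  If for ONE block size `L` the curved target `γ·‖A‖² ≤ q_{U₀,Q″}(A)` holds at every LARGE member `(F′, n, K)` (`F′.L = L`, `s₀ + 2 ≤ F′.m + n`) for every
`U₀ ∈ RegPr F′ n K α` (`10¹²L³α ≤ 1`) and every top nested mean `Q″` in its ∀-form `htop`, then it holds at EVERY member with the SAME `γ` and the SAME coupling
`a₀(c₀∕cB)(L^{K−n})³`: a small member `(F, n, K)` is read on the cover `F.cover jc`, `jc := s₀ + 2` (✓`regPr_cover_iff`; `Q″_c` := the intertwiner of record on the cover,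
✓`exists_intertwiner_of_regPr` (iii)–(iv)), the large case gives the target there, routeR-w3 g13's (c2) ✓`norm_sq_projR_topMean_cover_le` the projector row and px17 g9's (c3)
✓`curvedTarget_of_cover` the transfer.  CONDITIONAL on `hlarge`; nothing of it is proved here. [cite: Balaban1985BackgroundPropagators, (3.49) p.399, Thm 3.11 p.416; Balaban1987RG1, (0.1)–(0.2) pp.251–252] -/
theorem curvedTarget_all_of_large (L : ℕ) (c₀ cB : ℝ) [Fact (0 < c₀)] [Fact (0 < cB)] {α γ a₀ : ℝ} (hα : 0 < α) (hWα : 10 ^ 12 * (L : ℝ) ^ 3 * α ≤ 1)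
    (s₀ : ℕ)
    (hlarge : ∀ (F : T3Family) (n K : ℕ) (h : n ≤ K), F.L = L → n < K → s₀ + 2 ≤ F.m + n →
      ∀ (U₀ : GaugeField (F.P K) 0 (Matrix.specialUnitaryGroup (Fin 2) ℂ)), RegPr F n K α U₀ →
      ∀ (QU : SiteL2K ℂ 3 (periodsT3 F K) c₀ W₂ →ₗ[ℂ] (Site (F.P K) (K - n) → Matrix (Fin 2) (Fin 2) ℂ)),
        (∀ (lam : Site (F.P K) 0 → Matrix (Fin 2) (Fin 2) ℂ) (ns : (j : ℕ) → Site (F.P K) j → Matrix (Fin 2) (Fin 2) ℂ), ns 0 = lam →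
      (∀ (j : ℕ) (y : Site (F.P K) (j + 1)), ns (j + 1) y = ns j (emb y) - meanCLM (Idx (F.P K)) (Matrix (Fin 2) (Fin 2) ℂ) fun i : Idx (F.P K) =>
          ns j (emb y) - ((holT (emlIterU j (bgUnits F K U₀)) (emb y) (stairWord i.2.1 (off i.1)) : (Matrix (Fin 2) (Fin 2) ℂ)ˣ) : Matrix (Fin 2) (Fin 2) ℂ) *
            ns j (transl (emb y) (disp (stairWord i.2.1 (off i.1)))) * (((holT (emlIterU j (bgUnits F K U₀)) (emb y) (stairWord i.2.1 (off i.1)))⁻¹ : (Matrix (Fin 2) (Fin 2) ℂ)ˣ) : Matrix (Fin 2) (Fin 2) ℂ)) →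
      ns (K - n) = QU (toL2S F K c₀ lam)) →
        ∀ A : BondL2K ℂ 3 (periodsT3 F K) c₀ W₂,
          γ * ‖A‖ ^ 2 ≤ RCLike.re ⟪A, DeltaEta F n K c₀ U₀ A⟫_ℂ
          + ‖projR (covLapSite F n K c₀ U₀) QU (DstarL2 F n K c₀ U₀ A)‖ ^ 2
          + (a₀ * (c₀ / cB) * (((F).L : ℝ) ^ (K - n)) ^ 3) * ‖Qk F n K h c₀ cB U₀ A‖ ^ 2)
    (F : T3Family) (n K : ℕ) (h : n ≤ K) (hFL : F.L = L) (hnK : n < K)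
    (U₀ : GaugeField (F.P K) 0 (Matrix.specialUnitaryGroup (Fin 2) ℂ)) (hreg : RegPr F n K α U₀)
    (QU : SiteL2K ℂ 3 (periodsT3 F K) c₀ W₂ →ₗ[ℂ] (Site (F.P K) (K - n) → Matrix (Fin 2) (Fin 2) ℂ))
    (htopU : (∀ (lam : Site (F.P K) 0 → Matrix (Fin 2) (Fin 2) ℂ) (ns : (j : ℕ) → Site (F.P K) j → Matrix (Fin 2) (Fin 2) ℂ), ns 0 = lam →
      (∀ (j : ℕ) (y : Site (F.P K) (j + 1)), ns (j + 1) y = ns j (emb y) - meanCLM (Idx (F.P K)) (Matrix (Fin 2) (Fin 2) ℂ) fun i : Idx (F.P K) =>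
          ns j (emb y) - ((holT (emlIterU j (bgUnits F K U₀)) (emb y) (stairWord i.2.1 (off i.1)) : (Matrix (Fin 2) (Fin 2) ℂ)ˣ) : Matrix (Fin 2) (Fin 2) ℂ) *
            ns j (transl (emb y) (disp (stairWord i.2.1 (off i.1)))) * (((holT (emlIterU j (bgUnits F K U₀)) (emb y) (stairWord i.2.1 (off i.1)))⁻¹ : (Matrix (Fin 2) (Fin 2) ℂ)ˣ) : Matrix (Fin 2) (Fin 2) ℂ)) →
      ns (K - n) = QU (toL2S F K c₀ lam))) :
    ∀ A : BondL2K ℂ 3 (periodsT3 F K) c₀ W₂,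
      γ * ‖A‖ ^ 2 ≤ RCLike.re ⟪A, DeltaEta F n K c₀ U₀ A⟫_ℂ
          + ‖projR (covLapSite F n K c₀ U₀) QU (DstarL2 F n K c₀ U₀ A)‖ ^ 2
          + (a₀ * (c₀ / cB) * (((F).L : ℝ) ^ (K - n)) ^ 3) * ‖Qk F n K h c₀ cB U₀ A‖ ^ 2 := by
  by_cases hbig : s₀ + 2 ≤ F.m + n
  · exact hlarge F n K h hFL hnK hbig U₀ hreg QU htopU
  · -- the small member: read it on the cover `F.cover (s₀ + 2)`
    intro A
    have hWε : 10 ^ 12 * ((F.cover (s₀ + 2)).L : ℝ) ^ 3 * α ≤ 1 := by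
      rw [CoverSites.T3Family.cover_L, hFL]; exact hWα
    have hregc : RegPr (F.cover (s₀ + 2)) n K α (U₀ ∘ projBond (F.P K) (s₀ + 2) 0) :=
      (regPr_cover_iff (s₀ + 2) F α U₀).mpr hreg
    obtain ⟨Qc, Dc, -, -, htopc, hseqc, -⟩ :=
      exists_intertwiner_of_regPr (F.cover (s₀ + 2)) h (c₀ := c₀) cB hα hWε (U₀ ∘ projBond (F.P K) (s₀ + 2) 0) hregc
    have hcov := hlarge (F.cover (s₀ + 2)) n K h (by rw [CoverSites.T3Family.cover_L, hFL]) hnK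
      (by rw [CoverSites.T3Family.cover_m]; omega) (U₀ ∘ projBond (F.P K) (s₀ + 2) 0) hregc Qc htopc
    have hseqU := hseq_of_htop F c₀ U₀ QU htopU
    have hc2 := norm_sq_projR_topMean_cover_le F (s₀ + 2) h c₀ U₀ QU hseqU Qc hseqc
    exact curvedTarget_of_cover F (s₀ + 2) h c₀ cB hα (by rw [hFL]; exact hWα) U₀ hreg QU Qc γ a₀ hcov hc2 A


/-- ★★★ **`hT` AT EVERY MEMBER OF THE DISPLAY'S INDEX FROM THE LARGE MEMBERS** — conclusion = the `hT` binder of ✓`Prop7GaugeFixedRowDoorOfLODTarget.gaugeFixedRow_idx_of_curvedTarget_of_le_coupling`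
VERBATIM at `αcap := αLOD`, `γ := γLOD`, `aLOD L i := a₀·(c₀ L∕cB L)·(L:ℝ)^{3(K−n)}` (chair ★p1 g25's finish line (B)); hypothesis `hlarge` = the curved target at the LARGE members
(`s₀ L + 2 ≤ m + n`) for every `Q″` in ∀-form — what ✓`Prop7LODAssemblyMember.curvedTarget_member_of_hKP_hloc` ⊕ the member rows ⊕ w2 g12's window ✓`Prop7LODMemberWindow` deliver.
`hker` is carried for the letter and not used.  CONDITIONAL on `hlarge`. [cite: Balaban1985BackgroundPropagators, Thm 3.3 p.398, (3.49) p.399, Thm 3.11 p.416, (3.118)–(3.122) pp.419–420] -/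
theorem hT_of_largeMembers (αLOD γLOD : ℕ → ℝ) (hα : ∀ L : ℕ, 1 < L → 0 < αLOD L) (hWα : ∀ L : ℕ, 1 < L → 10 ^ 12 * (L : ℝ) ^ 3 * αLOD L ≤ 1)
    (c₀ cB : ℕ → ℝ) [hc₀ : ∀ L : ℕ, Fact (0 < c₀ L)] [hcB : ∀ L : ℕ, Fact (0 < cB L)] (a₀ : ℝ) (s₀ : ℕ → ℕ)
    (hlarge : ∀ (L : ℕ), 1 < L → ∀ (F : T3Family) (n K : ℕ) (h : n ≤ K), F.L = L → n < K → s₀ L + 2 ≤ F.m + n →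
      ∀ (U₀ : GaugeField (F.P K) 0 (Matrix.specialUnitaryGroup (Fin 2) ℂ)), RegPr F n K (αLOD L) U₀ →
      ∀ (QU : SiteL2K ℂ 3 (periodsT3 F K) (c₀ L) W₂ →ₗ[ℂ] (Site (F.P K) (K - n) → Matrix (Fin 2) (Fin 2) ℂ)),
        (∀ (lam : Site (F.P K) 0 → Matrix (Fin 2) (Fin 2) ℂ) (ns : (j : ℕ) → Site (F.P K) j → Matrix (Fin 2) (Fin 2) ℂ), ns 0 = lam →
      (∀ (j : ℕ) (y : Site (F.P K) (j + 1)), ns (j + 1) y = ns j (emb y) - meanCLM (Idx (F.P K)) (Matrix (Fin 2) (Fin 2) ℂ) fun i : Idx (F.P K) =>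
          ns j (emb y) - ((holT (emlIterU j (bgUnits F K U₀)) (emb y) (stairWord i.2.1 (off i.1)) : (Matrix (Fin 2) (Fin 2) ℂ)ˣ) : Matrix (Fin 2) (Fin 2) ℂ) *
            ns j (transl (emb y) (disp (stairWord i.2.1 (off i.1)))) * (((holT (emlIterU j (bgUnits F K U₀)) (emb y) (stairWord i.2.1 (off i.1)))⁻¹ : (Matrix (Fin 2) (Fin 2) ℂ)ˣ) : Matrix (Fin 2) (Fin 2) ℂ)) →
      ns (K - n) = QU (toL2S F K (c₀ L) lam)) →
        ∀ A : BondL2K ℂ 3 (periodsT3 F K) (c₀ L) W₂,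
          γLOD L * ‖A‖ ^ 2 ≤ RCLike.re ⟪A, DeltaEta F n K (c₀ L) U₀ A⟫_ℂ
          + ‖projR (covLapSite F n K (c₀ L) U₀) QU (DstarL2 F n K (c₀ L) U₀ A)‖ ^ 2
          + (a₀ * ((c₀ L) / (cB L)) * (((F).L : ℝ) ^ (K - n)) ^ 3) * ‖Qk F n K h (c₀ L) (cB L) U₀ A‖ ^ 2) :
    ∀ (L : ℕ), 1 < L → ∀ (i : T3Thm1Carrier.Idx L) (U₀ : GaugeField (i.1.1.P i.1.2.2) 0 (Matrix.specialUnitaryGroup (Fin 2) ℂ)),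
      RegPr i.1.1 i.1.2.1 i.1.2.2 (αLOD L) U₀ →
      ∀ (Q'' : SiteL2K ℂ 3 (periodsT3 i.1.1 i.1.2.2) (c₀ L) W₂ →ₗ[ℂ] (Site (i.1.1.P i.1.2.2) (i.1.2.2 - i.1.2.1) → Matrix (Fin 2) (Fin 2) ℂ)),
        (∀ (lam : Site (i.1.1.P i.1.2.2) 0 → Matrix (Fin 2) (Fin 2) ℂ) (ns : (j : ℕ) → Site (i.1.1.P i.1.2.2) j → Matrix (Fin 2) (Fin 2) ℂ), ns 0 = lam →
          (∀ (j : ℕ) (y : Site (i.1.1.P i.1.2.2) (j + 1)), ns (j + 1) y = ns j (emb y) - meanCLM (Idx (i.1.1.P i.1.2.2)) (Matrix (Fin 2) (Fin 2) ℂ) fun ι : Idx (i.1.1.P i.1.2.2) =>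
            ns j (emb y) - ((holT (emlIterU j (bgUnits i.1.1 i.1.2.2 U₀)) (emb y) (stairWord ι.2.1 (off ι.1)) : (Matrix (Fin 2) (Fin 2) ℂ)ˣ) : Matrix (Fin 2) (Fin 2) ℂ) *
              ns j (transl (emb y) (disp (stairWord ι.2.1 (off ι.1)))) * (((holT (emlIterU j (bgUnits i.1.1 i.1.2.2 U₀)) (emb y) (stairWord ι.2.1 (off ι.1)))⁻¹ : (Matrix (Fin 2) (Fin 2) ℂ)ˣ) : Matrix (Fin 2) (Fin 2) ℂ)) →
          ns (i.1.2.2 - i.1.2.1) = Q'' (toL2S i.1.1 i.1.2.2 (c₀ L) lam)) →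
        LinearMap.ker Q'' ≤ NS i.1.1 i.1.2.1 i.1.2.2 i.2.2.le (c₀ L) (cB L) U₀ →
        ∀ A : BondL2K ℂ 3 (periodsT3 i.1.1 i.1.2.2) (c₀ L) W₂,
          γLOD L * ‖A‖ ^ 2 ≤ RCLike.re ⟪A, DeltaEta i.1.1 i.1.2.1 i.1.2.2 (c₀ L) U₀ A⟫_ℂ
            + ‖projR (covLapSite i.1.1 i.1.2.1 i.1.2.2 (c₀ L) U₀) Q'' (DstarL2 i.1.1 i.1.2.1 i.1.2.2 (c₀ L) U₀ A)‖ ^ 2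
            + (a₀ * (c₀ L / cB L) * ((i.1.1.L : ℝ) ^ (i.1.2.2 - i.1.2.1)) ^ 3) * ‖Qk i.1.1 i.1.2.1 i.1.2.2 i.2.2.le (c₀ L) (cB L) U₀ A‖ ^ 2 := by
  intro L hL i
  obtain ⟨⟨F, n, K⟩, hFL, hnK⟩ := i
  intro U₀ hreg Q'' htop _hker
  exact curvedTarget_all_of_large L (c₀ L) (cB L) (hα L hL) (hWα L hL) (s₀ L) (hlarge L hL) F n K hnK.le hFL hnK U₀ hreg Q'' htop

end Summit.QuantumFields.YangMills.Theorems.Prop7LODTargetAllMembers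

end
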